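import Literature.MathematicalPhysics.QuantumFieldTheory.Balaban1983to89.Beta.RootedComb
import Literature.MathematicalPhysics.QuantumFieldTheory.Balaban1983to89.Beta.AveragingHessianKernelsRooted

/-!
# Reflection laws of the centre-rooted averaging kernels (`q¹`, `h`, and the product-chart `m` WITH its contact terms), letter level and packed

HONEST FRAMING (cell rule, verbatim): discharging `BetaPertH` makes Bałaban's UV stability UNCONDITIONAL — a real
constructive-QFT result; it is NOT the continuum limit and NOT the Clay problem.  This file discharges nothing of it: it is
[folklore] transport of structure (finite letter-list algebra) for the kernels of node 7aρ
(`Beta.AveragingHessianKernelsRooted`) at the CENTRED root `ρ_c = ctr d L`, `L` odd, under the block-compatible reflection of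
one lattice axis (`Beta.ResolventReflection.sref/bref/R1`, `Beta.RootedComb` §5).  Nothing printed is asserted.

WHAT IS PROVED (`α` the reflected axis, `ε_κ = reflSign α κ`, integer copy `zsgn`; bond map `fref α (κ, x) = (κ, bref α κ x)`;
block map `y ↦ y′ = bref α μ y`; `c = ctr d L`, `Odd L`):

* §1 list algebra: `wedge_append`, `wedge_rev` (`wedge (rev l) = −wedge l`), `wedge` of rescaled pair lists, pair lists are
  determined by their two projections;
* §2 **`hessCountAt_eq_sum_wedge`** — for EVERY root `ρ`: `hessCountAt ρ L μ y f f′ = Σ_{x ∈ B(y)} wedge(Γ^ρ_{c,x}; δ_f, δ_{f′})`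
  (the two closing-bond terms of node 7a's three-term formula cancel identically against the closing segment of the loops);
* §3 transport of the single-bond forms and of the centred pair words: `R1_single`, `gammaCAt_pairForm_R1_of_ne/_self`;
* §4 THE PURE SIGN LAWS: **`linCountAt_fref`** `q(f̄)_{(μ,y)} = ε_{f.1} ε_μ q(f)_{(μ,y′)}`, **`cCountAt_fref`**, and
  **`hessCountAt_fref`** `h(f̄,f̄′)_{(μ,y)} = ε_{f.1} ε_{f′.1} ε_μ h(f,f′)_{(μ,y′)}`;
* §5 **THE PRODUCT-CHART FIELD–MULTIPLIER KERNEL IS COVARIANT ONLY UP TO TWO CONTACT TERMS**: **`vhCountAt_fref`**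
  `ε_{f.1} ε_{f′.1} · m(f̄,f̄′)_{(μ,y)} = ε_μ m(f,f′)_{(μ,y′)} − 2ε_μ L^d [f = f′ ∥ α] q(f)_{(μ,y′)} − (1 − ε_μ) q(f)_{(μ,y′)} q(f′)_{(μ,y′)}`
  (unnormalised counts), and the decided `d = 1` witness **`vhCountAt_not_signCovariant`** that NO pure sign law holds; the
  two defects are the same-bond BCH contact of the product chart `U = e^W e^B` on `α`-bonds (there the reflected letter is
  `(e^W e^B)⁻¹ = e^{−B} e^{−W}`, order flipped) and, on the reflected coarse axis `μ = α`, the rank-one `q ⊗ q` term;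
* §6 the same laws for the real kernels `linKerAt`, `hessKerAt`, `vhKerAt` of node 7aρ §7;
* §7 (v1.1) THE PACKED LAWS IN THE (Sr)/(Wr) CURRENCY OF `Beta.ResolventReflection` (`refK (Φ L α)`, `ε_{κ′} • ·`; dimension
  `d + 1`, an2's `Fib d` / `MKer`): the reflection transport `TKer α` of a per-coarse-bond family and the intertwining
  **`packVH_bref`** `packVH K L κ′ (bref α κ′ u) = ε_{κ′} • refK (Φ L α) (packVH (TKer α K) L κ′ u)` (every `K`, `L ≥ 1`; block
  algebra `off_mref_eq_zero_iff`, `blk_mref`); `TKer_hessKerAt` (`h` invariant), the contact family **`ctE α L`**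
  `= [f = f′ ∥ α] q¹(f) − [μ = α] q¹(f) q¹(f′)` with **`TKer_ctE`** (`𝒯_α E_α = −E_α`) and **`TKer_vhKerAt`** (`𝒯_α m = m − E_α`);
  hence **`vhSaddAt_reflect`** — node 7aρ's ADDITIVE-CHART stencil family obeys the shape `hSr` VERBATIM, every axis;
  **`hessFFAt_reflect`** — the packed W-Hessian of the constraint obeys the `(Wr)`-type law `hessFFAt c L μ (bref α μ y) =
  ε_μ • refK (Φ N α) (hessFFAt c L μ y)`, any `N`; **`vhSAt_bref`** — the PRODUCT-CHART stencil family obeys `hSr` exactly up to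
  the packed contact stencil `packVH (ctE α L)`, which is `hSr`-ANTIcovariant (**`ctS_antireflect`**), so `m − ½E_α` is
  `hSr`-covariant for its own axis (**`vhSAt_half_reflect`**); and the decided packed witness **`vhSAt_not_reflect`**
  (`d + 1 = 1`, `L = 3`: entry `−1` vs `0`) that the product-chart family violates `hSr`.

USE (NOTE X-an5-18 / RULING (R33): inputs under either branch (A) product chart with conjugation or (B) additive chart;
nothing downstream is asserted here): these are the letter-level inputs to the
transport of `PolarizationSign.AxisReflectionCovariant` through a centred dressing ((R32-2) «by transport alone»).  The
kernels packed by pure signs are `q¹ = linKerAt` (§6 `linKerAt_fref`) and `h = hessKerAt` (§6 `hessKerAt_fref`), hence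
node 7aρ's ADDITIVE-CHART stencil `vhSaddAt = packVH hessKerAt`; the PRODUCT-CHART stencil `vhSAt = packVH vhKerAt` carries the
two contact terms of §5–§6 (`vhKerAt_fref`) and is not sign-covariant (`vhCountAt_not_signCovariant`).  §7 states all of
this in the binder currency an2 consumes: under branch (B) `vhSaddAt_reflect` + `hessFFAt_reflect` are the centred
averaging's contributions to `hSr` / to the Λ-part vertex law AS TYPED; under branch (A) `vhSAt_bref` + `ctS_antireflect` name
the exact (Sr)-defect of the product-chart stencil (the packed contact stencil) that a conjugated W-side law must compensate.

Provenance: b2b-balaban β sub-cell, unit beta-an5 gen 17 (node ROOTED-KERNEL-REFLECTION; NOTE X-an5-18, lead RULING (R33-1) GO —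
programme decisions, not citations), 2026-08-19; over
`Beta.RootedComb` v1 and an1's `Beta.AveragingHessianKernelsRooted` v1 BY NAME (nothing of theirs re-typed).
Bib keys (locators only): Balaban1985Averaging, Balaban1987RG1.

VERSION v1.1 (2026-08-19, b2b-balaban-beta-an5-g17, same session): + §7 (packed laws in the (Sr)/(Wr) currency; 24 declarations
appended: 2 defs `TKer`, `ctE` + 22 theorems); §1–§6 byte-identical to v1.
VERSION v1 (2026-08-19, b2b-balaban-beta-an5-g17): new leaf.
-/

namespace Literature.MathematicalPhysics.QuantumFieldTheory.Balaban1983to89.Beta.RootedKernelReflection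

open Finset
open scoped BigOperators
open AffineAveraging (Form1 unitVec box toSite)
open AveragingContours (segUp segDown rev axial rev_sum segUp_length)
open AveragingContoursRooted (gammaCAt loopCAt linAvgAt ctr)
open TransportedContourVariables (mapForm mapForm_apply pairForm pairForm_apply bg fl bg_cons fl_cons bg_append fl_append
  segUp_map rev_map mapForm_fst_pairForm mapForm_snd_pairForm)
open AveragingHessianKernels (wedge wedge_nil wedge_cons Bond single single_apply δ1 smulPair smulPair_apply
  sum_bg_map_smulPair sum_fl_map_smulPair pairForm_single single_eq_mapForm)
open AveragingHessianKernelsRooted (linCountAt cCountAt hessCountAt vhCountAt linKerAt hessKerAt vhKerAt gammaCAt_map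
  linAvgAt_single segUp_root_sum_single)
open PolarizationSign (reflSign)
open ResolventReflection (sref bref bref_bref bref_of_ne bref_self R1 R1_apply bflip bflip_mem bflip_bflip sum_box_bflip
  reflSign_self reflSign_of_ne reflSign_mul_self)
open RootedComb (gammaCAt_R1_of_ne gammaCAt_R1_self segUp_R1_of_ne segUp_R1_self segDown_eq_rev_segUp sref_root_ctr
  rev_append rev_rev linAvgAt_R1)

variable {d : ℕ}

/-! ## §1 List algebra -/

section ListAlgebra

variable {R : Type*} [CommRing R]

/-- [folklore] Concatenation law of the wedge count: the cross terms of the two blocks. -/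
theorem wedge_append (l₁ l₂ : List (R × R)) :
    wedge (l₁ ++ l₂) = wedge l₁ + wedge l₂ + ((bg l₁).sum * (fl l₂).sum - (fl l₁).sum * (bg l₂).sum) := by
  induction l₁ with
  | nil => simp
  | cons p l ih =>
    simp only [List.cons_append, wedge_cons, ih, bg_append, fl_append, List.sum_append, bg_cons, fl_cons, List.sum_cons]
    ring

/-- [folklore] First letters of a reversed pair list. -/
theorem bg_rev (l : List (R × R)) : bg (rev l) = rev (bg l) := by
  simp [bg, rev, List.map_reverse, List.map_map, Function.comp_def]

/-- [folklore] Second letters of a reversed pair list. -/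
theorem fl_rev (l : List (R × R)) : fl (rev l) = rev (fl l) := by
  simp [fl, rev, List.map_reverse, List.map_map, Function.comp_def]

/-- [folklore] `rev (p :: l) = rev l ++ [−p]`. -/
theorem rev_cons' (p : R × R) (l : List (R × R)) : rev (p :: l) = rev l ++ [-p] := by
  simp [rev]

/-- [folklore] **The wedge count of the REVERSED list (order reversed, letters negated) is minus the wedge count.** -/
theorem wedge_rev (l : List (R × R)) : wedge (rev l) = -wedge l := by
  induction l with
  | nil => simp [rev]
  | cons p l ih =>
    rw [rev_cons', wedge_append, ih, wedge_cons, bg_rev, fl_rev, rev_sum, rev_sum]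
    simp only [wedge_cons, wedge_nil, bg, fl, List.map_nil, List.map_cons, List.sum_cons, List.sum_nil, Prod.fst_neg,
      Prod.snd_neg]
    ring

/-- [folklore] The wedge count of a rescaled pair list `(a·m, b·n)`. -/
theorem wedge_map_mul (a b : R) (l : List (R × R)) :
    wedge (l.map fun p => (a * p.1, b * p.2)) = a * b * wedge l := by
  induction l with
  | nil => simp
  | cons p l ih =>
    have hb : (bg (l.map fun p => (a * p.1, b * p.2))).sum = a * (bg l).sum := by
      simp [bg, List.map_map, Function.comp_def, List.sum_map_mul_left]
    have hf : (fl (l.map fun p => (a * p.1, b * p.2))).sum = b * (fl l).sum := by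
      simp [fl, List.map_map, Function.comp_def, List.sum_map_mul_left]
    rw [List.map_cons, wedge_cons, ih, hb, hf, wedge_cons]
    ring

/-- [folklore] The wedge count of the integer pair list read in `ℝ` (scaling by `smulPair 1 1`) is the cast. -/
theorem wedge_map_smulPair_one (l : List (ℤ × ℤ)) :
    wedge (l.map (smulPair (1 : ℝ) (1 : ℝ))) = ((wedge l : ℤ) : ℝ) := by
  induction l with
  | nil => simp
  | cons p l ih =>
    rw [List.map_cons, wedge_cons, wedge_cons, ih, sum_fl_map_smulPair, sum_bg_map_smulPair, smulPair_apply]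
    simp only [Int.smul_one_eq_cast, Int.cast_add, Int.cast_sub, Int.cast_mul]

/-- [folklore] A list of pairs is determined by its two projections. -/
theorem eq_of_bg_fl {α β : Type*} {l l' : List (α × β)} (h1 : bg l = bg l') (h2 : fl l = fl l') : l = l' := by
  induction l generalizing l' with
  | nil =>
    cases l' with
    | nil => rfl
    | cons q l' => simp [bg] at h1
  | cons p l ih =>
    cases l' with
    | nil => simp [bg] at h1
    | cons q l' =>
      simp only [bg_cons, fl_cons, List.cons.injEq] at h1 h2
      rw [Prod.ext h1.1 h2.1, ih h1.2 h2.2]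

end ListAlgebra

/-! ## §2 The W-Hessian count is the sum of the wedge counts of the OPEN contours (every root) -/

section Open

variable {R : Type*} [AddCommGroup R]

/-- [folklore] First letters of the pair word along `Γ^ρ` are the word of the first form. -/
theorem bg_gammaCAt_pairForm (ρ : Fin d → ℤ) (A B : Form1 d R) (L : ℕ) (μ : Fin d) (y : Fin d → ℤ) (b : Fin d → ℕ) :
    bg (gammaCAt ρ (pairForm A B) L μ y b) = gammaCAt ρ A L μ y b := by
  change List.map Prod.fst _ = _
  rw [← AddMonoidHom.coe_fst, gammaCAt_map, mapForm_fst_pairForm]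

/-- [folklore] Second letters of the pair word along `Γ^ρ` are the word of the second form. -/
theorem fl_gammaCAt_pairForm (ρ : Fin d → ℤ) (A B : Form1 d R) (L : ℕ) (μ : Fin d) (y : Fin d → ℤ) (b : Fin d → ℕ) :
    fl (gammaCAt ρ (pairForm A B) L μ y b) = gammaCAt ρ B L μ y b := by
  change List.map Prod.snd _ = _
  rw [← AddMonoidHom.coe_snd, gammaCAt_map, mapForm_snd_pairForm]

/-- [folklore] First letters of the pair word along a straight segment. -/
theorem bg_segUp_pairForm (A B : Form1 d R) (z : Fin d → ℤ) (κ : Fin d) (n : ℕ) :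
    bg (segUp (pairForm A B) z κ n) = segUp A z κ n := by
  change List.map Prod.fst _ = _
  rw [← AddMonoidHom.coe_fst, segUp_map, mapForm_fst_pairForm]

/-- [folklore] Second letters of the pair word along a straight segment. -/
theorem fl_segUp_pairForm (A B : Form1 d R) (z : Fin d → ℤ) (κ : Fin d) (n : ℕ) :
    fl (segUp (pairForm A B) z κ n) = segUp B z κ n := by
  change List.map Prod.snd _ = _
  rw [← AddMonoidHom.coe_snd, segUp_map, mapForm_snd_pairForm]

/-- [folklore] **THE W-HESSIAN COUNT IS THE SUM OF THE WEDGE COUNTS OF THE OPEN ROOTED CONTOURS** `Γ^ρ_{c,x}`, `x ∈ B(y)`,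
for EVERY root `ρ`: the closing segment `−c` of the loops and node 7a's two compensating terms cancel identically. -/
theorem hessCountAt_eq_sum_wedge (ρ : Fin d → ℤ) (L : ℕ) (μ : Fin d) (y : Fin d → ℤ) (f f' : Bond d) :
    hessCountAt ρ L μ y f f' = ∑ b ∈ box d L, wedge (gammaCAt ρ (pairForm (δ1 f) (δ1 f')) L μ y b) := by
  set s := segUp (pairForm (δ1 f) (δ1 f')) ((L : ℤ) • y + ρ) μ L with hs
  have hbs : (bg s).sum = cCountAt ρ L μ y f := by rw [hs, bg_segUp_pairForm]; rfl
  have hfs : (fl s).sum = cCountAt ρ L μ y f' := by rw [hs, fl_segUp_pairForm]; rfl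
  have hloop : ∀ b, wedge (loopCAt ρ (pairForm (δ1 f) (δ1 f')) L μ y b)
      = wedge (gammaCAt ρ (pairForm (δ1 f) (δ1 f')) L μ y b) - wedge s
        - (gammaCAt ρ (δ1 f) L μ y b).sum * cCountAt ρ L μ y f'
        + (gammaCAt ρ (δ1 f') L μ y b).sum * cCountAt ρ L μ y f := by
    intro b
    rw [show loopCAt ρ (pairForm (δ1 f) (δ1 f')) L μ y b = gammaCAt ρ (pairForm (δ1 f) (δ1 f')) L μ y b ++ rev s
        from rfl, wedge_append, wedge_rev, bg_rev, fl_rev, rev_sum, rev_sum, hbs, hfs, bg_gammaCAt_pairForm,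
      fl_gammaCAt_pairForm]
    ring
  have hlin : ∀ g : Bond d, ∑ b ∈ box d L, (gammaCAt ρ (δ1 g) L μ y b).sum = linCountAt ρ L μ y g := fun g => rfl
  have hcard : (box d L).card = L ^ d := by simp [AffineAveraging.box, Fintype.card_piFinset]
  rw [hessCountAt, Finset.sum_congr rfl fun b _ => hloop b]
  simp only [Finset.sum_add_distrib, Finset.sum_sub_distrib, Finset.sum_const, hcard, ← Finset.sum_mul, hlin]
  rw [← hs]
  ring

end Open

/-! ## §3 The bond reflection, the integer signs, and the transport of single-bond forms and pair words -/

section Transport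

/-- [folklore] THE IMAGE OF THE FINE BOND `f = (κ, x)` under the reflection of axis `α`: same direction, base point
`bref α κ x` (an `α`-bond is re-based at its other endpoint, `ResolventReflection.bref`). -/
def fref (α : Fin d) (f : Bond d) : Bond d := (f.1, bref α f.1 f.2)

/-- [folklore] Direction of the reflected bond. -/
@[simp] theorem fref_fst (α : Fin d) (f : Bond d) : (fref α f).1 = f.1 := rfl

/-- [folklore] Base point of the reflected bond. -/
@[simp] theorem fref_snd (α : Fin d) (f : Bond d) : (fref α f).2 = bref α f.1 f.2 := rfl

/-- [folklore] `fref α` is an involution. -/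
@[simp] theorem fref_fref (α : Fin d) (f : Bond d) : fref α (fref α f) = f := by
  rcases f with ⟨κ, x⟩; simp [fref]

/-- [folklore] `fref α` is injective. -/
theorem fref_injective (α : Fin d) : Function.Injective (fref (d := d) α) := fun f g h => by
  rw [← fref_fref α f, h, fref_fref]

/-- [folklore] THE INTEGER SIGN `ε_κ` of a `κ`-leg under the reflection of axis `α` (`= reflSign α κ` read in `ℤ`). -/
def zsgn (α κ : Fin d) : ℤ := if κ = α then -1 else 1

/-- [folklore] `(zsgn α κ : ℝ) = reflSign α κ`. -/
@[simp] theorem cast_zsgn (α κ : Fin d) : ((zsgn α κ : ℤ) : ℝ) = reflSign α κ := by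
  unfold zsgn PolarizationSign.reflSign; split_ifs <;> simp

/-- [folklore] `ε_α = −1`. -/
theorem zsgn_self (α : Fin d) : zsgn α α = -1 := by simp [zsgn]

/-- [folklore] `ε_κ = 1` for `κ ≠ α`. -/
theorem zsgn_of_ne {α κ : Fin d} (h : κ ≠ α) : zsgn α κ = 1 := by simp [zsgn, h]

/-- [folklore] `ε_κ² = 1`. -/
theorem zsgn_mul_self (α κ : Fin d) : zsgn α κ * zsgn α κ = 1 := by
  unfold zsgn; split_ifs <;> simp

/-- [folklore] **THE PULL-BACK OF A SINGLE-BOND FORM IS THE SIGNED SINGLE-BOND FORM ON THE REFLECTED BOND**: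
`R1 α (c·δ_f) = (ε_{f.1} c)·δ_{f̄}`. -/
theorem R1_single (α : Fin d) (f : Bond d) (c : ℝ) : R1 α (single f c) = single (fref α f) (reflSign α f.1 * c) := by
  funext κ x
  rw [R1_apply, single_apply, single_apply]
  by_cases h : (κ, x) = fref α f
  · have h1 : κ = f.1 := congrArg Prod.fst h
    have h2 : x = bref α f.1 f.2 := congrArg Prod.snd h
    have h' : (κ, bref α κ x) = f := by
      rw [h1, h2, bref_bref]
    rw [if_pos h', if_pos h, h1]
  · have h' : (κ, bref α κ x) ≠ f := by
      intro h'
      apply h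
      have h1 : κ = f.1 := congrArg Prod.fst h'
      have h2 : bref α κ x = f.2 := congrArg Prod.snd h'
      refine Prod.ext h1 ?_
      show x = bref α f.1 f.2
      rw [← h1, ← h2, bref_bref]
    rw [if_neg h', if_neg h, mul_zero]

/-- [folklore] The single-bond form on the reflected bond, as a pull-back: `δ_{f̄} = ε_{f.1} · R1 α δ_f` (unit weight). -/
theorem single_fref (α : Fin d) (f : Bond d) :
    single (fref α f) (1 : ℝ) = reflSign α f.1 • R1 α (single f 1) := by
  rw [R1_single, mul_one]
  funext κ x
  simp only [Pi.smul_apply, single_apply, smul_eq_mul]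
  split_ifs
  · rw [reflSign_mul_self]
  · rw [mul_zero]

/-- [folklore] The word of `(a•A, b•B)` is the rescaled word of `(A, B)`. -/
theorem gammaCAt_pairForm_smul (ρ : Fin d → ℤ) (a b : ℝ) (A B : Form1 d ℝ) (L : ℕ) (μ : Fin d) (y : Fin d → ℤ)
    (x : Fin d → ℕ) :
    gammaCAt ρ (pairForm (a • A) (b • B)) L μ y x = (gammaCAt ρ (pairForm A B) L μ y x).map fun p => (a * p.1, b * p.2) := by
  have : pairForm (a • A) (b • B)
      = mapForm ((AddMonoidHom.mulLeft a).prodMap (AddMonoidHom.mulLeft b)) (pairForm A B) := by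
    funext κ z; rfl
  rw [this, ← gammaCAt_map]
  rfl

/-- [folklore] **TRANSPORT OF THE CENTRED PAIR WORD ACROSS THE AXIS** (`μ ≠ α`, `L` odd): the pair word of
`(R1 A, R1 B)` along `Γ^{ρ_c}_{(μ,y),x}` IS the pair word of `(A, B)` along the reflected contour, as LISTS. -/
theorem gammaCAt_pairForm_R1_of_ne {L : ℕ} (hL : Odd L) {α μ : Fin d} (h : μ ≠ α) (A B : Form1 d ℝ) (y : Fin d → ℤ)
    {b : Fin d → ℕ} (hb : b ∈ box d L) :
    gammaCAt (ctr d L) (pairForm (R1 α A) (R1 α B)) L μ y b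
      = gammaCAt (ctr d L) (pairForm A B) L μ (sref α y) (bflip α L b) := by
  apply eq_of_bg_fl
  · rw [bg_gammaCAt_pairForm, bg_gammaCAt_pairForm, gammaCAt_R1_of_ne hL h A y hb]
  · rw [fl_gammaCAt_pairForm, fl_gammaCAt_pairForm, gammaCAt_R1_of_ne hL h B y hb]

/-- [folklore] **TRANSPORT OF THE CENTRED PAIR WORD ALONG THE AXIS** (`μ = α`, `L` odd): the pair word of `(R1 A, R1 B)`
along `Γ^{ρ_c}_{(α,y),x}` is the REVERSED pair word of `(A, B)` along the contour of the re-based reflected bond. -/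
theorem gammaCAt_pairForm_R1_self {L : ℕ} (hL : Odd L) (α : Fin d) (A B : Form1 d ℝ) (y : Fin d → ℤ)
    {b : Fin d → ℕ} (hb : b ∈ box d L) :
    gammaCAt (ctr d L) (pairForm (R1 α A) (R1 α B)) L α y b
      = rev (gammaCAt (ctr d L) (pairForm A B) L α (bref α α y) (bflip α L b)) := by
  apply eq_of_bg_fl
  · rw [bg_gammaCAt_pairForm, bg_rev, bg_gammaCAt_pairForm, gammaCAt_R1_self hL α A y hb]
  · rw [fl_gammaCAt_pairForm, fl_rev, fl_gammaCAt_pairForm, gammaCAt_R1_self hL α B y hb]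

/-- [folklore] **AT THE LEVEL OF WEDGE COUNTS, ONE LAW FOR ALL AXES:**
`wedge(Γ^{ρ_c}_{(μ,y),x}; R1 A, R1 B) = ε_μ · wedge(Γ^{ρ_c}_{(μ, bref y), x̃}; A, B)` (`L` odd). -/
theorem wedge_gammaCAt_pairForm_R1 {L : ℕ} (hL : Odd L) (α μ : Fin d) (A B : Form1 d ℝ) (y : Fin d → ℤ)
    {b : Fin d → ℕ} (hb : b ∈ box d L) :
    wedge (gammaCAt (ctr d L) (pairForm (R1 α A) (R1 α B)) L μ y b)
      = reflSign α μ * wedge (gammaCAt (ctr d L) (pairForm A B) L μ (bref α μ y) (bflip α L b)) := by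
  by_cases h : μ = α
  · subst h
    rw [gammaCAt_pairForm_R1_self hL μ A B y hb, wedge_rev, reflSign_self, neg_one_mul]
  · rw [gammaCAt_pairForm_R1_of_ne hL h A B y hb, reflSign_of_ne h, one_mul, bref_of_ne h]

end Transport

/-! ## §4 The pure sign laws: `q¹`, the coarse-bond count, and the W-Hessian count `h` -/

section PureLaws

/-- [folklore] The integer count `q¹` read in `ℝ` through the unit single-bond form. -/
theorem cast_linCountAt (ρ : Fin d → ℤ) (L : ℕ) (μ : Fin d) (y : Fin d → ℤ) (f : Bond d) :
    ((linCountAt ρ L μ y f : ℤ) : ℝ) = linAvgAt ρ (single f (1 : ℝ)) L μ y := by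
  rw [linAvgAt_single, Int.smul_one_eq_cast]

/-- [folklore] The coarse-bond count read in `ℝ`. -/
theorem cast_cCountAt (ρ : Fin d → ℤ) (L : ℕ) (μ : Fin d) (y : Fin d → ℤ) (f : Bond d) :
    ((cCountAt ρ L μ y f : ℤ) : ℝ) = (segUp (single f (1 : ℝ)) ((L : ℤ) • y + ρ) μ L).sum := by
  rw [segUp_root_sum_single, Int.smul_one_eq_cast]

/-- [folklore] The W-Hessian count read in `ℝ`: the sum of the wedge counts of the real unit pair words. -/
theorem cast_hessCountAt (ρ : Fin d → ℤ) (L : ℕ) (μ : Fin d) (y : Fin d → ℤ) (f f' : Bond d) :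
    ((hessCountAt ρ L μ y f f' : ℤ) : ℝ)
      = ∑ b ∈ box d L, wedge (gammaCAt ρ (pairForm (single f (1 : ℝ)) (single f' (1 : ℝ))) L μ y b) := by
  rw [hessCountAt_eq_sum_wedge, Int.cast_sum]
  refine Finset.sum_congr rfl fun b _ => ?_
  rw [pairForm_single, ← gammaCAt_map, wedge_map_smulPair_one]

/-- [folklore] **THE LINEAR KERNEL IS REFLECTION-COVARIANT** (centred root, `L` odd, every axis):
`q(f̄)_{(μ, y)} = ε_{f.1} ε_μ · q(f)_{(μ, y′)}`, `y′ = bref α μ y` (unnormalised counts). -/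
theorem linCountAt_fref {L : ℕ} (hL : Odd L) (α μ : Fin d) (y : Fin d → ℤ) (f : Bond d) :
    linCountAt (ctr d L) L μ y (fref α f) = zsgn α f.1 * zsgn α μ * linCountAt (ctr d L) L μ (bref α μ y) f := by
  have key : linAvgAt (ctr d L) (R1 α (single f (1 : ℝ))) L μ y
      = reflSign α μ * linAvgAt (ctr d L) (single f (1 : ℝ)) L μ (bref α μ y) := by
    rw [linAvgAt_R1 hL, R1_apply]
  rw [R1_single, mul_one, linAvgAt_single, linAvgAt_single, zsmul_eq_mul, zsmul_eq_mul, mul_one] at key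
  have h2 : ((linCountAt (ctr d L) L μ y (fref α f) : ℤ) : ℝ)
      = reflSign α f.1 * reflSign α μ * linCountAt (ctr d L) L μ (bref α μ y) f := by
    linear_combination (reflSign α f.1) * key
      - (linCountAt (ctr d L) L μ y (fref α f) : ℝ) * reflSign_mul_self α f.1
  have h3 : ((linCountAt (ctr d L) L μ y (fref α f) : ℤ) : ℝ)
      = ((zsgn α f.1 * zsgn α μ * linCountAt (ctr d L) L μ (bref α μ y) f : ℤ) : ℝ) := by
    rw [Int.cast_mul, Int.cast_mul, cast_zsgn, cast_zsgn]; exact h2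
  exact_mod_cast h3

/-- [folklore] **THE COARSE-BOND COUNT IS REFLECTION-COVARIANT** (centred root, `L` odd): `c(f̄)_{(μ,y)} = ε_{f.1} ε_μ c(f)_{(μ,y′)}`. -/
theorem cCountAt_fref {L : ℕ} (hL : Odd L) (α μ : Fin d) (y : Fin d → ℤ) (f : Bond d) :
    cCountAt (ctr d L) L μ y (fref α f) = zsgn α f.1 * zsgn α μ * cCountAt (ctr d L) L μ (bref α μ y) f := by
  have key : (segUp (R1 α (single f (1 : ℝ))) ((L : ℤ) • y + ctr d L) μ L).sum
      = reflSign α μ * (segUp (single f (1 : ℝ)) ((L : ℤ) • bref α μ y + ctr d L) μ L).sum := by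
    by_cases h : μ = α
    · subst h
      rw [segUp_R1_self, sref_root_ctr hL, segDown_eq_rev_segUp, rev_sum, reflSign_self, bref_self, smul_sub,
        neg_one_mul]
      congr 3
      abel
    · rw [segUp_R1_of_ne h, sref_root_ctr hL, reflSign_of_ne h, one_mul, bref_of_ne h]
  rw [R1_single, mul_one] at key
  have hs : ∀ (g : Bond d) (c : ℝ) (z : Fin d → ℤ),
      (segUp (single g c) z μ L).sum = c * (segUp (single g (1 : ℝ)) z μ L).sum := by
    intro g c z
    have : single g c = mapForm (AddMonoidHom.mulLeft c) (single g (1 : ℝ)) := by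
      funext κ x; simp only [single_apply, mapForm_apply, AddMonoidHom.coe_mulLeft]; split_ifs <;> simp
    rw [this, ← segUp_map, ← map_list_sum]; rfl
  rw [hs, ← cast_cCountAt, ← cast_cCountAt] at key
  have h2 : ((cCountAt (ctr d L) L μ y (fref α f) : ℤ) : ℝ)
      = reflSign α f.1 * reflSign α μ * cCountAt (ctr d L) L μ (bref α μ y) f := by
    linear_combination (reflSign α f.1) * key
      - (cCountAt (ctr d L) L μ y (fref α f) : ℝ) * reflSign_mul_self α f.1
  have h3 : ((cCountAt (ctr d L) L μ y (fref α f) : ℤ) : ℝ)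
      = ((zsgn α f.1 * zsgn α μ * cCountAt (ctr d L) L μ (bref α μ y) f : ℤ) : ℝ) := by
    rw [Int.cast_mul, Int.cast_mul, cast_zsgn, cast_zsgn]; exact h2
  exact_mod_cast h3

/-- [folklore] **THE W-HESSIAN KERNEL IS REFLECTION-COVARIANT** (centred root, `L` odd, every axis):
`h(f̄, f̄′)_{(μ,y)} = ε_{f.1} ε_{f′.1} ε_μ · h(f, f′)_{(μ,y′)}` (unnormalised counts). -/
theorem hessCountAt_fref {L : ℕ} (hL : Odd L) (α μ : Fin d) (y : Fin d → ℤ) (f f' : Bond d) :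
    hessCountAt (ctr d L) L μ y (fref α f) (fref α f')
      = zsgn α f.1 * zsgn α f'.1 * zsgn α μ * hessCountAt (ctr d L) L μ (bref α μ y) f f' := by
  have h2 : ((hessCountAt (ctr d L) L μ y (fref α f) (fref α f') : ℤ) : ℝ)
      = reflSign α f.1 * reflSign α f'.1 * reflSign α μ * hessCountAt (ctr d L) L μ (bref α μ y) f f' := by
    rw [cast_hessCountAt, cast_hessCountAt, single_fref, single_fref, Finset.mul_sum,
      ← sum_box_bflip α L (fun b => reflSign α f.1 * reflSign α f'.1 * reflSign α μ *
          wedge (gammaCAt (ctr d L) (pairForm (single f (1 : ℝ)) (single f' (1 : ℝ))) L μ (bref α μ y) b))]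
    refine Finset.sum_congr rfl fun b hb => ?_
    rw [gammaCAt_pairForm_smul, wedge_map_mul, wedge_gammaCAt_pairForm_R1 hL α μ _ _ y hb]
    ring
  have h3 : ((hessCountAt (ctr d L) L μ y (fref α f) (fref α f') : ℤ) : ℝ)
      = ((zsgn α f.1 * zsgn α f'.1 * zsgn α μ * hessCountAt (ctr d L) L μ (bref α μ y) f f' : ℤ) : ℝ) := by
    rw [Int.cast_mul, Int.cast_mul, Int.cast_mul, cast_zsgn, cast_zsgn, cast_zsgn]; exact h2
  exact_mod_cast h3

end PureLaws

/-! ## §5 The product-chart field–multiplier count: covariance UP TO TWO CONTACT TERMS, and the witness that no pure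
sign law holds -/

section ProductChart

/-- [folklore] **REFLECTION LAW OF THE PRODUCT-CHART FIELD–MULTIPLIER COUNT** (centred root, `L` odd, every axis `α`):
`m(f̄, f̄′)_{(μ,y)} = ε_{f.1} ε_{f′.1} · ( ε_μ m(f,f′)_{(μ,y′)} − 2ε_μ L^d [f = f′ ∧ f ∥ α] q(f)_{(μ,y′)} − (1 − ε_μ) q(f)_{(μ,y′)} q(f′)_{(μ,y′)} )`
(unnormalised: `m = vhCountAt = 2L^{2d}·m_b`, `q = linCountAt = L^d·q¹_b`).  The pure part is the law of `h` and `q`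
(§4); the two CONTACT TERMS are the same-bond BCH contact `[W, B]` of the product chart `U = e^W e^B` on `α`-bonds (node
7a's `½ Z([W,B]_bw)` summand transforms without the orientation sign) and, on the reflected coarse axis `μ = α` only, the
rank-one `q ⊗ q` summand (node 7a's `−½[ZW, ZB]`, even where odd is demanded). -/
theorem vhCountAt_fref {L : ℕ} (hL : Odd L) (α μ : Fin d) (y : Fin d → ℤ) (f f' : Bond d) :
    vhCountAt (ctr d L) L μ y (fref α f) (fref α f')
      = zsgn α f.1 * zsgn α f'.1 *
          (zsgn α μ * vhCountAt (ctr d L) L μ (bref α μ y) f f'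
            - 2 * (L : ℤ) ^ d * zsgn α μ * (if f = f' ∧ f.1 = α then linCountAt (ctr d L) L μ (bref α μ y) f else 0)
            - (1 - zsgn α μ) * (linCountAt (ctr d L) L μ (bref α μ y) f * linCountAt (ctr d L) L μ (bref α μ y) f')) := by
  rw [vhCountAt, vhCountAt, hessCountAt_fref hL, linCountAt_fref hL, linCountAt_fref hL]
  have hμ := zsgn_mul_self α μ
  obtain rfl | hne := eq_or_ne f f'
  · rw [if_pos rfl, if_pos rfl]
    by_cases h1 : f.1 = α
    · have e1 : zsgn α f.1 = -1 := by rw [h1]; exact zsgn_self α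
      rw [if_pos ⟨rfl, h1⟩, e1]
      linear_combination (-(linCountAt (ctr d L) L μ (bref α μ y) f * linCountAt (ctr d L) L μ (bref α μ y) f)) * hμ
    · rw [if_neg (fun h => h1 h.2), zsgn_of_ne h1]
      linear_combination (-(linCountAt (ctr d L) L μ (bref α μ y) f * linCountAt (ctr d L) L μ (bref α μ y) f)) * hμ
  · have hne' : fref α f ≠ fref α f' := fun h => hne (fref_injective α h)
    rw [if_neg hne', if_neg hne, if_neg (fun h => hne h.1)]
    linear_combination
      (-(zsgn α f.1 * zsgn α f'.1 * linCountAt (ctr d L) L μ (bref α μ y) f * linCountAt (ctr d L) L μ (bref α μ y) f'))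
        * hμ

/-- [folklore] The same law with the signs moved to the other side (`ε² = 1`). -/
theorem vhCountAt_fref' {L : ℕ} (hL : Odd L) (α μ : Fin d) (y : Fin d → ℤ) (f f' : Bond d) :
    zsgn α f.1 * zsgn α f'.1 * vhCountAt (ctr d L) L μ y (fref α f) (fref α f')
      = zsgn α μ * vhCountAt (ctr d L) L μ (bref α μ y) f f'
        - 2 * (L : ℤ) ^ d * zsgn α μ * (if f = f' ∧ f.1 = α then linCountAt (ctr d L) L μ (bref α μ y) f else 0)
        - (1 - zsgn α μ) * (linCountAt (ctr d L) L μ (bref α μ y) f * linCountAt (ctr d L) L μ (bref α μ y) f') := by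
  rw [vhCountAt_fref hL]
  have hf := zsgn_mul_self α f.1
  have hf' := zsgn_mul_self α f'.1
  linear_combination
    ((zsgn α μ * vhCountAt (ctr d L) L μ (bref α μ y) f f'
        - 2 * (L : ℤ) ^ d * zsgn α μ * (if f = f' ∧ f.1 = α then linCountAt (ctr d L) L μ (bref α μ y) f else 0)
        - (1 - zsgn α μ) * (linCountAt (ctr d L) L μ (bref α μ y) f * linCountAt (ctr d L) L μ (bref α μ y) f'))
      * (zsgn α f'.1 * zsgn α f'.1)) * hf
    + ((zsgn α μ * vhCountAt (ctr d L) L μ (bref α μ y) f f'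
        - 2 * (L : ℤ) ^ d * zsgn α μ * (if f = f' ∧ f.1 = α then linCountAt (ctr d L) L μ (bref α μ y) f else 0)
        - (1 - zsgn α μ) * (linCountAt (ctr d L) L μ (bref α μ y) f * linCountAt (ctr d L) L μ (bref α μ y) f'))) * hf'

/-- [folklore] ACROSS the axis and OFF the `α`-diagonal the law is pure: for `μ ≠ α` and `¬(f = f′ ∧ f ∥ α)`,
`m(f̄,f̄′)_{(μ,y)} = ε_{f.1} ε_{f′.1} m(f,f′)_{(μ, sref y)}`. -/
theorem vhCountAt_fref_of_ne {L : ℕ} (hL : Odd L) {α μ : Fin d} (h : μ ≠ α) (y : Fin d → ℤ) {f f' : Bond d}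
    (hff : ¬(f = f' ∧ f.1 = α)) :
    vhCountAt (ctr d L) L μ y (fref α f) (fref α f')
      = zsgn α f.1 * zsgn α f'.1 * vhCountAt (ctr d L) L μ (sref α y) f f' := by
  rw [vhCountAt_fref hL, if_neg hff, zsgn_of_ne h, bref_of_ne h]
  ring

/-- [folklore] **NO PURE SIGN LAW HOLDS** — decided witness (`d = 1`, `L = 3`, centre root `1`, `μ = α = 0`; block `y = 0`
with coarse-bond fine bonds `c₁ c₂ c₃`, mirror block `y′ = −2` with `c₋₅ c₋₄ c₋₃`, `fref : c₋₅ ↦ c₃, c₋₄ ↦ c₂`):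
`m_0(c₃, c₂) = −18` while `m_{−2}(c₋₅, c₋₄) = 0`. -/
theorem vhCountAt_toy_values :
    vhCountAt (fun _ => 1) 3 (0 : Fin 1) (fun _ => 0) (0, fun _ => 3) (0, fun _ => 2) = -18 ∧
    vhCountAt (fun _ => 1) 3 (0 : Fin 1) (fun _ => -2) (0, fun _ => -5) (0, fun _ => -4) = 0 ∧
    linCountAt (fun _ => 1) 3 (0 : Fin 1) (fun _ => -2) (0, fun _ => -5) = 3 ∧
    linCountAt (fun _ => 1) 3 (0 : Fin 1) (fun _ => -2) (0, fun _ => -4) = 3 := by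
  decide

/-- [folklore] The toy data ARE an instance of the centred reflection: `ctr 1 3 = 1`, `fref 0 (0, −5) = (0, 3)`,
`fref 0 (0, −4) = (0, 2)`, `bref 0 0 0 = −2`. -/
theorem toy_is_reflection :
    ctr 1 3 = (fun _ => 1) ∧ fref (0 : Fin 1) (0, fun _ => -5) = (0, fun _ => 3) ∧
    fref (0 : Fin 1) (0, fun _ => -4) = (0, fun _ => 2) ∧ bref (0 : Fin 1) 0 (fun _ => 0) = fun _ => -2 := by
  refine ⟨?_, ?_, ?_, ?_⟩
  · funext i; simp [AveragingContoursRooted.ctr_apply]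
  · refine Prod.ext rfl ?_; funext i; simp [fref, ResolventReflection.bref_apply, Fin.fin_one_eq_zero i]
  · refine Prod.ext rfl ?_; funext i; simp [fref, ResolventReflection.bref_apply, Fin.fin_one_eq_zero i]
  · funext i; simp [ResolventReflection.bref_apply, Fin.fin_one_eq_zero i]

/-- [folklore] **THE PRODUCT-CHART FIELD–MULTIPLIER KERNEL IS NOT REFLECTION-COVARIANT BY ANY SIGN**: at the centred root
of the `d = 1`, `L = 3` toy, `m_{(0,0)}(f̄, f̄′) ≠ ± m_{(0, y′)}(f, f′)` for `f = c₋₅`, `f′ = c₋₄`. -/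
theorem vhCountAt_not_signCovariant :
    vhCountAt (ctr 1 3) 3 (0 : Fin 1) (fun _ => 0) (fref 0 (0, fun _ => -5)) (fref 0 (0, fun _ => -4)) ≠
        vhCountAt (ctr 1 3) 3 (0 : Fin 1) (bref (0 : Fin 1) 0 (fun _ => 0)) (0, fun _ => -5) (0, fun _ => -4) ∧
      vhCountAt (ctr 1 3) 3 (0 : Fin 1) (fun _ => 0) (fref 0 (0, fun _ => -5)) (fref 0 (0, fun _ => -4)) ≠
        -vhCountAt (ctr 1 3) 3 (0 : Fin 1) (bref (0 : Fin 1) 0 (fun _ => 0)) (0, fun _ => -5) (0, fun _ => -4) := by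
  obtain ⟨hc, h5, h4, hb⟩ := toy_is_reflection
  rw [hc, h5, h4, hb, vhCountAt_toy_values.1, vhCountAt_toy_values.2.1]
  decide

end ProductChart

/-! ## §6 The laws for the real kernels of node 7aρ §7 (`q¹ = q/L^d`, `h = h/(2L^d)`, `m = m/(2L^{2d})`) -/

section RealKernels

/-- [folklore] `q¹(f̄)_{(μ,y)} = ε_{f.1} ε_μ q¹(f)_{(μ,y′)}`. -/
theorem linKerAt_fref {L : ℕ} (hL : Odd L) (α μ : Fin d) (y : Fin d → ℤ) (f : Bond d) :
    linKerAt (ctr d L) L μ y (fref α f) = reflSign α f.1 * reflSign α μ * linKerAt (ctr d L) L μ (bref α μ y) f := by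
  rw [linKerAt, linKerAt, linCountAt_fref hL]
  push_cast
  rw [cast_zsgn, cast_zsgn]
  ring

/-- [folklore] `h(f̄,f̄′)_{(μ,y)} = ε_{f.1} ε_{f′.1} ε_μ h(f,f′)_{(μ,y′)}`. -/
theorem hessKerAt_fref {L : ℕ} (hL : Odd L) (α μ : Fin d) (y : Fin d → ℤ) (f f' : Bond d) :
    hessKerAt (ctr d L) L μ y (fref α f) (fref α f')
      = reflSign α f.1 * reflSign α f'.1 * reflSign α μ * hessKerAt (ctr d L) L μ (bref α μ y) f f' := by
  rw [hessKerAt, hessKerAt, hessCountAt_fref hL]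
  push_cast
  rw [cast_zsgn, cast_zsgn, cast_zsgn]
  ring

/-- [folklore] **THE REAL PRODUCT-CHART FIELD–MULTIPLIER KERNEL UNDER THE REFLECTION**:
`m(f̄,f̄′)_{(μ,y)} = ε_{f.1} ε_{f′.1} ( ε_μ m(f,f′)_{(μ,y′)} − ε_μ [f = f′ ∧ f ∥ α] q¹(f)_{(μ,y′)} − [μ = α] q¹(f)_{(μ,y′)} q¹(f′)_{(μ,y′)} )`. -/
theorem vhKerAt_fref {L : ℕ} (hL : Odd L) (α μ : Fin d) (y : Fin d → ℤ) (f f' : Bond d) :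
    vhKerAt (ctr d L) L μ y (fref α f) (fref α f')
      = reflSign α f.1 * reflSign α f'.1 *
          (reflSign α μ * vhKerAt (ctr d L) L μ (bref α μ y) f f'
            - reflSign α μ * (if f = f' ∧ f.1 = α then linKerAt (ctr d L) L μ (bref α μ y) f else 0)
            - (if μ = α then linKerAt (ctr d L) L μ (bref α μ y) f * linKerAt (ctr d L) L μ (bref α μ y) f' else 0)) := by
  have hL0 : (L : ℝ) ≠ 0 := by
    have : 1 ≤ L := hL.pos
    exact_mod_cast (by omega : L ≠ 0)
  have hLd : (L : ℝ) ^ d ≠ 0 := pow_ne_zero _ hL0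
  rw [vhKerAt, vhKerAt, linKerAt, linKerAt, vhCountAt_fref hL]
  push_cast
  rw [cast_zsgn, cast_zsgn, cast_zsgn]
  by_cases hμ : μ = α
  · rw [if_pos hμ, hμ, reflSign_self]
    split_ifs
    · field_simp
      ring
    · field_simp
      ring
  · rw [if_neg hμ, reflSign_of_ne hμ]
    split_ifs
    · field_simp
      ring
    · field_simp
      ring

end RealKernels

/-! ## §7 The packed laws, in the (Sr)/(Wr) currency of `Beta.ResolventReflection` (`refK (Φ L α)`, `reflSign α κ′ • ·`)

Dimension `d + 1` (an2's index types `Fib d`, `MKer (d+1) (Fib d)`); the blocking factor of the reflection leg map `Φ` is the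
averaging's own `L` (multiplier legs at the fine images `L • y` of the coarse sites, node 7a's packer `packVH`). -/

section Packed

open ExpKernelCalculus (MKer)
open OneStepResolventKernel (Fib)
open KernelReflection (refK refK_apply)
open ResolventReflection (Φ Φ_r_inl Φ_r_inr Φ_s_inl Φ_s_inr mref mref_mref mref_zsmul)
open AveragingContours (blk off blk_add_off)
open AveragingHessianKernels (packVH packVH_inl_inr packVH_inr_inl packVH_inl_inl packVH_inr_inr off_add_smul)
open AveragingHessianKernelsRooted (vhSAt vhSaddAt hessFFAt hessFFAt_inl_inl hessFFAt_inl_inr hessFFAt_inr)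

/-! ### 7.1 The reflection transport of a per-coarse-bond bond kernel family, and the block/offset algebra of `mref L` -/

/-- [folklore] THE REFLECTION TRANSPORT of a per-coarse-bond kernel family `K μ y f f′` (axis `α`):
`(𝒯_α K) μ y f f′ := ε_{f.1} ε_{f′.1} ε_μ · K μ (bref α μ y) f̄ f̄′`.  A family obeys the PURE sign law of §6 iff `𝒯_α K = K`. -/
noncomputable def TKer (α : Fin d) (K : Fin d → (Fin d → ℤ) → Bond d → Bond d → ℝ) :
    Fin d → (Fin d → ℤ) → Bond d → Bond d → ℝ :=
  fun μ y f f' => reflSign α f.1 * reflSign α f'.1 * reflSign α μ * K μ (bref α μ y) (fref α f) (fref α f')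

/-- [folklore] Entries of the transport. -/
@[simp] theorem TKer_apply (α : Fin d) (K : Fin d → (Fin d → ℤ) → Bond d → Bond d → ℝ) (μ : Fin d) (y : Fin d → ℤ)
    (f f' : Bond d) :
    TKer α K μ y f f' = reflSign α f.1 * reflSign α f'.1 * reflSign α μ * K μ (bref α μ y) (fref α f) (fref α f') := rfl

/-- [folklore] The transport is an involution. -/
@[simp] theorem TKer_TKer (α : Fin d) (K : Fin d → (Fin d → ℤ) → Bond d → Bond d → ℝ) : TKer α (TKer α K) = K := by
  funext μ y f f'
  simp only [TKer_apply, fref_fref, fref_fst, bref_bref]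
  have h1 := reflSign_mul_self α f.1
  have h2 := reflSign_mul_self α f'.1
  have h3 := reflSign_mul_self α μ
  linear_combination (K μ y f f' * (reflSign α f'.1 * reflSign α f'.1) * (reflSign α μ * reflSign α μ)) * h1
    + (K μ y f f' * (reflSign α μ * reflSign α μ)) * h2 + (K μ y f f') * h3

/-- [folklore] The transport is additive. -/
theorem TKer_sub (α : Fin d) (K K' : Fin d → (Fin d → ℤ) → Bond d → Bond d → ℝ) :
    TKer α (K - K') = TKer α K - TKer α K' := by
  funext μ y f f'; simp only [TKer_apply, Pi.sub_apply]; ring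

/-- [folklore] The transport commutes with negation. -/
theorem TKer_neg (α : Fin d) (K : Fin d → (Fin d → ℤ) → Bond d → Bond d → ℝ) : TKer α (-K) = -TKer α K := by
  funext μ y f f'; simp only [TKer_apply, Pi.neg_apply]; ring

/-- [folklore] **`h` IS TRANSPORT-INVARIANT** (§6 `hessKerAt_fref`, centred root, `L` odd). -/
theorem TKer_hessKerAt {L : ℕ} (hL : Odd L) (α : Fin d) : TKer α (hessKerAt (ctr d L) L) = hessKerAt (ctr d L) L := by
  funext μ y f f'
  rw [TKer_apply, hessKerAt_fref hL, bref_bref]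
  have h1 := reflSign_mul_self α f.1
  have h2 := reflSign_mul_self α f'.1
  have h3 := reflSign_mul_self α μ
  linear_combination (hessKerAt (ctr d L) L μ y f f' * (reflSign α f'.1 * reflSign α f'.1) * (reflSign α μ * reflSign α μ)) * h1
    + (hessKerAt (ctr d L) L μ y f f' * (reflSign α μ * reflSign α μ)) * h2 + (hessKerAt (ctr d L) L μ y f f') * h3

/-- [folklore] **THE CONTACT FAMILY OF THE PRODUCT CHART** for the reflection of axis `α` (§5–§6): the same-bond BCH contact on
`α`-bonds minus, on the reflected coarse axis `μ = α`, the rank-one term —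
`E_α μ y f f′ := [f = f′ ∧ f ∥ α] q¹(f)_{(μ,y)} − [μ = α] q¹(f)_{(μ,y)} q¹(f′)_{(μ,y)}`. -/
noncomputable def ctE (α : Fin d) (L : ℕ) : Fin d → (Fin d → ℤ) → Bond d → Bond d → ℝ := fun μ y f f' =>
  (if f = f' ∧ f.1 = α then linKerAt (ctr d L) L μ y f else 0)
    - (if μ = α then linKerAt (ctr d L) L μ y f * linKerAt (ctr d L) L μ y f' else 0)

/-- [folklore] **THE CONTACT FAMILY IS TRANSPORT-ODD**: `𝒯_α E_α = −E_α`. -/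
theorem TKer_ctE {L : ℕ} (hL : Odd L) (α : Fin d) : TKer α (ctE α L) = -ctE α L := by
  funext μ y f f'
  simp only [TKer_apply, ctE, Pi.neg_apply, fref_fst, linKerAt_fref hL, bref_bref, (fref_injective α).eq_iff]
  set q := linKerAt (ctr d L) L μ y f with hq
  set q' := linKerAt (ctr d L) L μ y f' with hq'
  have h1 := reflSign_mul_self α f.1
  have h2 := reflSign_mul_self α f'.1
  by_cases hff : f = f' ∧ f.1 = α
  · have e1 : reflSign α f.1 = -1 := by rw [hff.2]; exact reflSign_self α
    have e2 : reflSign α f'.1 = -1 := by rw [← hff.1, hff.2]; exact reflSign_self α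
    simp only [if_pos hff, e1, e2]
    by_cases hμ : μ = α
    · have e3 : reflSign α μ = -1 := by rw [hμ]; exact reflSign_self α
      simp only [if_pos hμ, e3]; ring
    · simp only [if_neg hμ, reflSign_of_ne hμ]; ring
  · simp only [if_neg hff]
    by_cases hμ : μ = α
    · have e3 : reflSign α μ = -1 := by rw [hμ]; exact reflSign_self α
      simp only [if_pos hμ, e3]
      linear_combination (q * q' * (reflSign α f'.1 * reflSign α f'.1)) * h1 + (q * q') * h2
    · simp only [if_neg hμ]; ring

/-- [folklore] **THE PRODUCT-CHART KERNEL UNDER THE TRANSPORT**: `𝒯_α m = m − E_α` (§6 `vhKerAt_fref`). -/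
theorem TKer_vhKerAt {L : ℕ} (hL : Odd L) (α : Fin d) :
    TKer α (vhKerAt (ctr d L) L) = vhKerAt (ctr d L) L - ctE α L := by
  funext μ y f f'
  simp only [TKer_apply, Pi.sub_apply, ctE, vhKerAt_fref hL, bref_bref]
  set v := vhKerAt (ctr d L) L μ y f f' with hv
  set q := linKerAt (ctr d L) L μ y f with hq
  set q' := linKerAt (ctr d L) L μ y f' with hq'
  have h1 := reflSign_mul_self α f.1
  have h2 := reflSign_mul_self α f'.1
  by_cases hff : f = f' ∧ f.1 = α
  · have e1 : reflSign α f.1 = -1 := by rw [hff.2]; exact reflSign_self α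
    have e2 : reflSign α f'.1 = -1 := by rw [← hff.1, hff.2]; exact reflSign_self α
    rw [if_pos hff, e1, e2]
    by_cases hμ : μ = α
    · rw [if_pos hμ, hμ, reflSign_self]; ring
    · rw [if_neg hμ, reflSign_of_ne hμ]; ring
  · rw [if_neg hff]
    by_cases hμ : μ = α
    · rw [if_pos hμ, hμ, reflSign_self]
      linear_combination ((v + q * q') * (reflSign α f'.1 * reflSign α f'.1)) * h1 + (v + q * q') * h2
    · rw [if_neg hμ, reflSign_of_ne hμ]
      linear_combination (v * (reflSign α f'.1 * reflSign α f'.1)) * h1 + v * h2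

variable {n : ℕ}

/-- [folklore] A fine image of a coarse site has offset zero. -/
theorem off_zsmul (L : ℕ) (q : Fin (n + 1) → ℤ) : off L ((L : ℤ) • q) = 0 := by
  have h0 : off L (0 : Fin (n + 1) → ℤ) = 0 := funext fun i => by simp [off]
  have := off_add_smul L 0 q
  rwa [zero_add, h0] at this

/-- [folklore] A fine point of offset zero IS the fine image of its block index. -/
theorem eq_zsmul_blk_of_off {L : ℕ} (hL : 1 ≤ L) {z : Fin (n + 1) → ℤ} (hz : off L z = 0) : z = (L : ℤ) • blk L z := by
  have h := blk_add_off hL z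
  rw [hz] at h
  have h0 : toSite (0 : Fin (n + 1) → ℕ) = 0 := AveragingContours.toSite_zero
  rw [h0, add_zero] at h
  exact h.symm

/-- [folklore] **`mref L` PRESERVES OFFSET ZERO** (the multiplier-leg map keeps the coarse sublattice, cf.
`ResolventReflection.proj_mref_eq_zero_iff`). -/
theorem off_mref_eq_zero_iff {L : ℕ} (hL : 1 ≤ L) (α μ : Fin (n + 1)) (z : Fin (n + 1) → ℤ) :
    off L (mref L α μ z) = 0 ↔ off L z = 0 := by
  constructor
  · intro h
    have e := eq_zsmul_blk_of_off hL h
    have : z = mref L α μ ((L : ℤ) • blk L (mref L α μ z)) := by rw [← e, mref_mref]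
    rw [this, mref_zsmul]
    exact off_zsmul L _
  · intro h
    rw [eq_zsmul_blk_of_off hL h, mref_zsmul]
    exact off_zsmul L _

/-- [folklore] **THE BLOCK INDEX OF A REFLECTED MULTIPLIER LEG** is the reflected coarse bond base: `blk (mref L α μ z) =
bref α μ (blk z)` for `z` of offset zero. -/
theorem blk_mref {L : ℕ} (hL : 1 ≤ L) (α μ : Fin (n + 1)) {z : Fin (n + 1) → ℤ} (hz : off L z = 0) :
    blk L (mref L α μ z) = bref α μ (blk L z) := by
  conv_lhs => rw [eq_zsmul_blk_of_off hL hz, mref_zsmul]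
  exact AxialProjector.blk_zsmul hL _

/-! ### 7.2 The packer intertwines the transport with the (Sr) operation -/

variable (K : Fin (n + 1) → (Fin (n + 1) → ℤ) → Bond (n + 1) → Bond (n + 1) → ℝ)

/-- [folklore] The packer is compatible with subtraction. -/
theorem packVH_sub (K' : Fin (n + 1) → (Fin (n + 1) → ℤ) → Bond (n + 1) → Bond (n + 1) → ℝ) (L : ℕ) (κ' : Fin (n + 1))
    (u : Fin (n + 1) → ℤ) : packVH (K - K') L κ' u = packVH K L κ' u - packVH K' L κ' u := by
  funext x z a b
  rcases a with β | μ <;> rcases b with β' | μ'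
  · simp
  · simp only [Pi.sub_apply, packVH_inl_inr]; split_ifs <;> simp
  · simp only [Pi.sub_apply, packVH_inr_inl]; split_ifs <;> simp
  · simp

/-- [folklore] The packer is compatible with negation. -/
theorem packVH_neg (L : ℕ) (κ' : Fin (n + 1)) (u : Fin (n + 1) → ℤ) : packVH (-K) L κ' u = -packVH K L κ' u := by
  funext x z a b
  rcases a with β | μ <;> rcases b with β' | μ'
  · simp
  · simp only [Pi.neg_apply, packVH_inl_inr]; split_ifs <;> simp
  · simp only [Pi.neg_apply, packVH_inr_inl]; split_ifs <;> simp
  · simp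

/-- [folklore] **THE PACKER INTERTWINES THE TRANSPORT WITH THE (Sr) OPERATION OF `Beta.ResolventReflection`**:
`packVH K L κ′ (bref α κ′ u) = ε_{κ′} • refK (Φ L α) (packVH (𝒯_α K) L κ′ u)` — every family `K`, every axis, every `L ≥ 1`. -/
theorem packVH_bref {L : ℕ} (hL : 1 ≤ L) (α κ' : Fin (n + 1)) (u : Fin (n + 1) → ℤ) :
    packVH K L κ' (bref α κ' u) = reflSign α κ' • refK (Φ L α) (packVH (TKer α K) L κ' u) := by
  funext x z a b
  simp only [Pi.smul_apply, smul_eq_mul, refK_apply]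
  have hκ := reflSign_mul_self α κ'
  rcases a with β | μ <;> rcases b with β' | μ'
  · simp
  · simp only [Φ_s_inl, Φ_s_inr, Φ_r_inl, Φ_r_inr, packVH_inl_inr]
    by_cases hz : off L z = 0
    · rw [if_pos hz, if_pos ((off_mref_eq_zero_iff hL α μ' z).2 hz), blk_mref hL α μ' hz, TKer_apply]
      simp only [fref, bref_bref]
      have hβ := reflSign_mul_self α β
      have hμ := reflSign_mul_self α μ'
      linear_combination (-(K μ' (blk L z) (β, x) (κ', bref α κ' u)) * (reflSign α β * reflSign α β) * (reflSign α μ' * reflSign α μ')) * hκ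
        - (K μ' (blk L z) (β, x) (κ', bref α κ' u) * (reflSign α μ' * reflSign α μ')) * hβ
        - (K μ' (blk L z) (β, x) (κ', bref α κ' u)) * hμ
    · rw [if_neg hz, if_neg (fun h => hz ((off_mref_eq_zero_iff hL α μ' z).1 h))]
      ring
  · simp only [Φ_s_inl, Φ_s_inr, Φ_r_inl, Φ_r_inr, packVH_inr_inl]
    by_cases hx : off L x = 0
    · rw [if_pos hx, if_pos ((off_mref_eq_zero_iff hL α μ x).2 hx), blk_mref hL α μ hx, TKer_apply]
      simp only [fref, bref_bref]
      have hβ := reflSign_mul_self α β'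
      have hμ := reflSign_mul_self α μ
      linear_combination (-(K μ (blk L x) (β', z) (κ', bref α κ' u)) * (reflSign α β' * reflSign α β') * (reflSign α μ * reflSign α μ)) * hκ
        - (K μ (blk L x) (β', z) (κ', bref α κ' u) * (reflSign α μ * reflSign α μ)) * hβ
        - (K μ (blk L x) (β', z) (κ', bref α κ' u)) * hμ
    · rw [if_neg hx, if_neg (fun h => hx ((off_mref_eq_zero_iff hL α μ x).1 h))]
      ring
  · simp

/-- [folklore] **A TRANSPORT-INVARIANT FAMILY PACKS TO AN (Sr)-COVARIANT STENCIL FAMILY** — the hypothesis shape `hSr` of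
`ResolventReflection.axisReflectionCovariant_flipK_hessKer` / `_TbalOf`, verbatim, for this axis. -/
theorem packVH_reflect_of_TKer {L : ℕ} (hL : 1 ≤ L) {α : Fin (n + 1)} (hK : TKer α K = K) (κ' : Fin (n + 1))
    (u : Fin (n + 1) → ℤ) : packVH K L κ' (bref α κ' u) = reflSign α κ' • refK (Φ L α) (packVH K L κ' u) := by
  rw [packVH_bref K hL, hK]

/-- [folklore] **A TRANSPORT-ODD FAMILY PACKS TO AN (Sr)-ANTICOVARIANT STENCIL FAMILY.** -/
theorem packVH_antireflect_of_TKer {L : ℕ} (hL : 1 ≤ L) {α : Fin (n + 1)} (hK : TKer α K = -K) (κ' : Fin (n + 1))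
    (u : Fin (n + 1) → ℤ) : packVH K L κ' (bref α κ' u) = -(reflSign α κ' • refK (Φ L α) (packVH K L κ' u)) := by
  rw [packVH_bref K hL, hK, packVH_neg]
  funext x z a b
  simp [refK_apply, Pi.smul_apply, smul_eq_mul]

/-! ### 7.3 The laws for node 7aρ's packed objects at the centred root -/

/-- [folklore] **(Sr) FOR THE ADDITIVE-CHART FIELD–MULTIPLIER STENCIL FAMILY** (`vhSaddAt = packVH h`, centred root, `L` odd):
`vhSaddAt c L κ′ (bref α κ′ u) = ε_{κ′} • refK (Φ L α) (vhSaddAt c L κ′ u)` — EVERY axis `α`: the shape `hSr`, verbatim. -/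
theorem vhSaddAt_reflect {L : ℕ} (hL : Odd L) (α κ' : Fin (n + 1)) (u : Fin (n + 1) → ℤ) :
    vhSaddAt (ctr (n + 1) L) n L rfl κ' (bref α κ' u)
      = reflSign α κ' • refK (Φ L α) (vhSaddAt (ctr (n + 1) L) n L rfl κ' u) :=
  packVH_reflect_of_TKer _ hL.pos (TKer_hessKerAt hL α) κ' u

/-- [folklore] **THE PRODUCT-CHART FIELD–MULTIPLIER STENCIL FAMILY: (Sr) UP TO THE PACKED CONTACT STENCIL** —
`vhSAt c L κ′ (bref α κ′ u) = ε_{κ′} • refK (Φ L α) (vhSAt c L κ′ u − packVH E_α L κ′ u)`. -/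
theorem vhSAt_bref {L : ℕ} (hL : Odd L) (α κ' : Fin (n + 1)) (u : Fin (n + 1) → ℤ) :
    vhSAt (ctr (n + 1) L) n L rfl κ' (bref α κ' u)
      = reflSign α κ' • refK (Φ L α) (vhSAt (ctr (n + 1) L) n L rfl κ' u - packVH (ctE α L) L κ' u) := by
  unfold vhSAt
  rw [packVH_bref _ hL.pos, TKer_vhKerAt hL, packVH_sub]

/-- [folklore] **THE PACKED CONTACT STENCIL IS (Sr)-ANTICOVARIANT**:
`packVH E_α L κ′ (bref α κ′ u) = −ε_{κ′} • refK (Φ L α) (packVH E_α L κ′ u)`. -/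
theorem ctS_antireflect {L : ℕ} (hL : Odd L) (α κ' : Fin (n + 1)) (u : Fin (n + 1) → ℤ) :
    packVH (ctE α L) L κ' (bref α κ' u) = -(reflSign α κ' • refK (Φ L α) (packVH (ctE α L) L κ' u)) :=
  packVH_antireflect_of_TKer _ hL.pos (TKer_ctE hL α) κ' u

/-- [folklore] **THE HALF-CORRECTED PRODUCT-CHART STENCIL IS (Sr)-COVARIANT FOR ITS OWN AXIS**: `m − ½E_α` obeys `hSr` at `α`
(the product-chart stencil splits as the `𝒯_α`-even part `m − ½E_α` plus the `𝒯_α`-odd part `½E_α`). -/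
theorem vhSAt_half_reflect {L : ℕ} (hL : Odd L) (α κ' : Fin (n + 1)) (u : Fin (n + 1) → ℤ) :
    vhSAt (ctr (n + 1) L) n L rfl κ' (bref α κ' u) - (1 / 2 : ℝ) • packVH (ctE α L) L κ' (bref α κ' u)
      = reflSign α κ' • refK (Φ L α)
          (vhSAt (ctr (n + 1) L) n L rfl κ' u - (1 / 2 : ℝ) • packVH (ctE α L) L κ' u) := by
  rw [vhSAt_bref hL, ctS_antireflect hL]
  funext x z a b
  simp only [Pi.smul_apply, Pi.sub_apply, Pi.neg_apply, smul_eq_mul, refK_apply]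
  ring

/-- [folklore] **(Wr)-TYPE LAW FOR THE PACKED W-HESSIAN OF THE CONSTRAINT** (`hessFFAt`, field–field block; centred root,
`L` odd; ANY blocking `N` of the leg map, the multiplier legs being absent):
`hessFFAt c L μ (bref α μ y) = ε_μ • refK (Φ N α) (hessFFAt c L μ y)`. -/
theorem hessFFAt_reflect {L : ℕ} (hL : Odd L) (N : ℕ) (α μ : Fin (n + 1)) (y : Fin (n + 1) → ℤ) :
    hessFFAt (ctr (n + 1) L) L μ (bref α μ y) = reflSign α μ • refK (Φ N α) (hessFFAt (ctr (n + 1) L) L μ y) := by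
  funext x x' a b
  simp only [Pi.smul_apply, smul_eq_mul, refK_apply]
  rcases a with β | ν
  · rcases b with β' | ν'
    · simp only [Φ_s_inl, Φ_r_inl, hessFFAt_inl_inl]
      have h := hessKerAt_fref hL α μ (bref α μ y) (β, bref α β x) (β', bref α β' x')
      simp only [fref, bref_bref] at h
      rw [h]
      ring
    · simp
  · simp

/-! ### 7.4 The packed witness: the product-chart stencil family violates (Sr) (toy `d + 1 = 1`, `L = 3`) -/

/-- [folklore] **THE PRODUCT-CHART STENCIL FAMILY OF THE CENTRED AVERAGING IS NOT (Sr)-COVARIANT**: in dimension one with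
`L = 3`, axis `α = 0 = κ′`, background bond base `u = −4`, the entry `((x = 3, inl 0), (z = 0, inr 0))` of the two sides of
`hSr` reads `−1` vs `0` (§5's witness `m_0(c₃,c₂) = −18`, `m_{−2}(c₋₅,c₋₄) = 0`, packed). -/
theorem vhSAt_not_reflect :
    vhSAt (ctr 1 3) 0 3 rfl 0 (bref (0 : Fin 1) 0 (fun _ => -4))
      ≠ reflSign (0 : Fin 1) 0 • refK (Φ 3 0) (vhSAt (ctr 1 3) 0 3 rfl 0 (fun _ => -4)) := by
  intro h
  have e := congrFun (congrFun (congrFun (congrFun h (fun _ => 3)) (fun _ => 0)) (Sum.inl 0)) (Sum.inr 0)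
  have hoff : off 3 (fun _ : Fin 1 => (0 : ℤ)) = 0 := by funext i; simp [off]
  have hblk : blk 3 (fun _ : Fin 1 => (0 : ℤ)) = fun _ => 0 := by funext i; simp [blk]
  have hm : mref 3 (0 : Fin 1) 0 (fun _ => (0 : ℤ)) = fun _ => -6 := by
    funext i; simp [mref, Fin.fin_one_eq_zero i]
  have hoff' : off 3 (fun _ : Fin 1 => (-6 : ℤ)) = 0 := by funext i; simp [off]
  have hblk' : blk 3 (fun _ : Fin 1 => (-6 : ℤ)) = fun _ => -2 := by funext i; simp [blk]
  have hb4 : bref (0 : Fin 1) 0 (fun _ => (-4 : ℤ)) = fun _ => 2 := by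
    funext i; simp [ResolventReflection.bref_apply, Fin.fin_one_eq_zero i]
  have hb3 : bref (0 : Fin 1) 0 (fun _ => (3 : ℤ)) = fun _ => -5 := by
    funext i; simp [ResolventReflection.bref_apply, Fin.fin_one_eq_zero i]
  obtain ⟨hc, -, -, -⟩ := toy_is_reflection
  simp only [vhSAt, packVH_inl_inr, Pi.smul_apply, smul_eq_mul, refK_apply, Φ_s_inl, Φ_s_inr, Φ_r_inl, Φ_r_inr, hoff,
    hblk, hm, hoff', hblk', hb4, hb3, if_true, vhKerAt] at e
  rw [hc, vhCountAt_toy_values.1, vhCountAt_toy_values.2.1] at e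
  norm_num [PolarizationSign.reflSign] at e

end Packed

end Literature.MathematicalPhysics.QuantumFieldTheory.Balaban1983to89.Beta.RootedKernelReflection
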